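import Literature.NumberTheory.FaltingsSerre.ResidualIdentificationOfKernel
import HarnessLib

/-!
# Cited-form instance `N = 587`, Fricke sign `−` ([BPPTVY, Thm 7.3.1]): `A₅₈₇` paramodular away from
# `587`, Step 1 by the `S₆` route in the kernel

[BPPTVY] = A. Brumer, A. Pacetti, C. Poor, G. Tornaría, J. Voight, D. S. Yuen, *On the paramodularity of
typical abelian surfaces*, Algebra & Number Theory **13**:5 (2019) 1145–1195 [cite: BrumerEtAl2019]
(printed numbering and pages): §7.3 and Theorem 7.3.1 p. 1191 — `A₅₈₇ = Jac(X₅₈₇)`,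
`X₅₈₇ : y² + (x³ + x + 1)y = −x² − x` (LMFDB `587.a.587.1`), conductor `587`, partner the MINUS form
`f⁻₅₈₇ ∈ S₂(K(587))⁻`, the Borcherds product (6.2.8)–(6.2.9) p. 1180, with
`Q₂(f⁻₅₈₇, t) = 1 + 3t + 5t² + 6t³ + 4t⁴`, `Q₃(f⁻₅₈₇, t) = 1 + 4t + 9t² + 12t³ + 9t⁴` printed as (6.2.10)
p. 1180: "For all primes `p` we have
`L_p(A₅₈₇, T) = Q_p(f⁻₅₈₇, T)`, and `A₅₈₇` is paramodular"; the proof (p. 1191) prints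
`Q₃(f, T) = 1 + 4T + 9T² + 12T³ + 9T⁴ ≡ 1 + T² + T⁴`, `Q₁₁(f, T) = 1 + T − T² + 11T³ + 121T⁴ ≡ Φ₅ (mod 2)`,
the `2`-division sextic `x⁶ − 2x⁵ + 2x⁴ − x² + 2x − 1` with group `S₆`, the residual identification
("the residual representation of `f⁻₅₈₇` corresponds then to the same extension as `A`, and since both
representations have the same trace at `Frob₃`, … they are indeed equivalent"), the degree-`20` field
(7.3.2) with `2¹⁹ − 1` quadratic extensions, and the check set (7.3.3) p. 1192
`{3, 5, 7, 11, 13, 17, 19, 23, 29, 37, 41}` = `checkPrimes587plus` of `Paramodular587plusCore.lean` (ONE set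
for both Fricke signs: it depends on `ρ̄_{A₅₈₇}` only).  Also: Alg 2.4.1 p. 1155, Thm 4.3.4 p. 1169,
Prop 4.3.2 p. 1168, (5.1.8) p. 1174, Lemma 7.1.4 pp. 1187–1188, p. 1188 (descent to `GSp₄(ℤ₂)`).

WHAT THIS FILE IS.  The companion of `paramodular_587plus_cited` / `paramodular_587plus_cited_of_kernel`
(`ParamodularCitedInstances.lean`, `ResidualIdentificationOfKernel.lean`) for the pair that IS in print:
the level-`587` minus pair on the cited-form template `paramodular_of_galoisCertificate_cited`
(cell record `DIVERGENCE.md` D-29) — NO posited `ρ_f`, `similitude₂`, `residual_conj`, `hρf`; instead the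
cited named fact `h438 : BrumerEtAl2019.existsIntegralSymplecticGaloisRep_two_primeLevel`
(ARTHUR-DEPENDENT), the curve-side Galois half `G : GaloisCertificate587 cyclotomicMultiplier ρA`
(`certs/587/galois/galois_certificate.canonical.json`, sha256
`5ba9346a657202460934ea21b5dd12813c66f8395b03112b83a27684d831ddaf`, verdict `galois_half: certified`,
GRH-free, image `S₆`, `K₀` = the printed degree-`20` field, `dim K₀(S,2) = 19`, `P(587)` = printed, ×2),
the residual identification datum, the integer tables and type (G) decided at `p₀ = 3`:
* `typeG_587minus_at_three`: `Q₃(f⁻₅₈₇) = 1 + 4T + 9T² + 12T³ + 9T⁴` (printed p. 1191), `(a₃, b₃) = (−4, 9)`: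
  `4 ≥ 0`, `16 ≤ 48`, `15 ≥ 0`, `192 ≤ 225`;
* `paramodular_587minus_cited`: `hres : ResidualIdentification 587 af bf ρA` as a binder (the Galois
  half's `residual` block: `ρ̄_f = ρ̄_A` from `Q_p mod 2` at `p ∈ [3, 11]` against the complete candidate
  lists ×2, exactly the printed argument);
* `paramodular_587minus_cited_of_kernel`: `hres` DERIVED in the kernel by the `S₆` route
  (`ResidualIdentification.of_kernel_of_range_eq`) from the kernel identification datum `hK`, the count
  `hcard : #im ρ̄_A = 720` (so `im ρ̄_A = ι(S₆)`, `GSp4F2.residual_range_eq_iotaGL_of_card`), and the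
  Frobenius datum at `q = 3`: `L₃(A₅₈₇) = 1 + 4T + 9T² + 12T³ + 9T⁴` (`a₃ = −4` even via `h5` and `hf3`,
  `b₃ = 9` odd — the binder `hb3`; certificate `curve_euler.L_p_at_Pstar.3`, PARI + naive counts ×2) —
  `Frob₃²` has order `3` and `tr ρ̄_A(Frob₃²) = tr σ̄(Frob₃²)` for every admissible `σ̄`, which fixes the
  embedding ("same trace at `Frob₃`", p. 1191).
The trace table `h5` (`a_p(A₅₈₇) = λ_p(f⁻₅₈₇) = −4, −2, 0, −1, −2, 0, −7, −5, 5, −4, 1` at `p = 3, …, 41`)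
and `h2` (`L₂(A₅₈₇) = Q₂(f⁻₅₈₇) = 1 + 3T + 5T² + 6T³ + 4T⁴`) are binders; their cell attestation is the
Galois half above (curve side) and the engineer-2 register `certs/587/eng2_form_hecke_587minus.canonical.json`
(sha256 `040464882f25b1ea9a3babb8cab5d36ca18ff64e4e5e6e173640dc8138dacd41`: `λ_p` at all eleven
certificate primes ×2 (E2d, E2f), `Q_p` for `p ≤ 11` ×2 or better, `b₁₁ = −1` ×2 (E2g, E2h) = printed);
the printed values are [cite: PoorYuen2015, Table 5 p. 1433] column `587`, `ε = −` (`λ₂ = −3, λ₃ = −4,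
λ₄ = 3, λ₅ = −2, λ₇ = 0, λ₉ = 6, λ₁₁ = −1`) and (6.2.10) p. 1180 / p. 1191 of [BPPTVY] (`Q₂`, `Q₃`, `Q₁₁`).  A merged minus-pair certificate (`certs/587/minus/`) is the
producer's to assemble; nothing in the kernel depends on it: the theorems below are implications, and
their conclusion is the printed theorem restricted to `p ≠ 587`.
-/

noncomputable section

namespace Literature.NumberTheory.FaltingsSerre

open Polynomial IsDedekindDomain Field Equiv
open Literature.NumberTheory.GaloisRepresentations Literature.NumberTheory.FaltingsSerre.GSp4F2
  Literature.NumberTheory.Automorphic.Paramodular Literature.NumberTheory.Automorphic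
  Literature.AlgebraicGeometry.Motives
open scoped NumberField

namespace Paramodular587minus

open Paramodular587plus

/-- Type (G) for `f⁻₅₈₇` at `3`, decided from the printed `Q₃(f⁻₅₈₇) = 1 + 4T + 9T² + 12T³ + 9T⁴`,
`(a₃, b₃) = (−4, 9)`: `0 ≤ 16 − 36 + 24`, `16 ≤ 48`, `0 ≤ 6 + 9`, `4·16·3 = 192 ≤ 225 = 15²`.
[cite: BrumerEtAl2019, Thm 7.3.1 (proof) p. 1191; Prop 4.3.2 p. 1168; Thm 4.3.4 p. 1169] [cite: MaisnerNart2002, Lemma 2.1 p. 323] -/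
theorem typeG_587minus_at_three (af bf : ℕ → ℤ) (hf3 : af 3 = -4 ∧ bf 3 = 9) :
    ∃ p : ℕ, p.Prime ∧ ¬ p ∣ 587 ∧ ∀ z : ℂ,
      ((lPolynomialOfSurface p (af p) (bf p)).map (Int.castRingHom ℂ)).IsRoot z →
        ‖z‖ = (Real.sqrt p)⁻¹ :=
  exists_typeG_of_ineq (N := 587) (p₀ := 3) (by norm_num) (by norm_num) af bf
    (by rw [hf3.1, hf3.2]; norm_num) (by rw [hf3.1]; norm_num) (by rw [hf3.2]; norm_num)
    (by rw [hf3.1, hf3.2]; norm_num)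

/-- **[BPPTVY, Thm 7.3.1] away from `587`, with the form side cited: `A₅₈₇` is paramodular of level
`587` with partner `f⁻₅₈₇`, GIVEN the binders.**  `paramodular_of_galoisCertificate_cited` at `N = 587`,
`T = checkPrimes587plus` (= the printed (7.3.3); `checkPrimes587plus_good`).  Binders: `h438` (cited,
ARTHUR-DEPENDENT); `G` the Galois half of `A₅₈₇` with multiplier `χ₂` (sha256 `5ba9346a…`); `hframe`;
`aA bA af bf` with `hA`, `hfe`; `hres` the residual identification datum (the Galois half's `residual`
block — the printed Step-1 argument of p. 1191); `h5` the trace table on the printed check set; `hcusp`,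
`hne`; `hf3 : (a₃, b₃)(f⁻₅₈₇) = (−4, 9)` (type (G) at `3`; printed (6.2.10)); `h2`
(`L₂ = Q₂ = 1 + 3T + 5T² + 6T³ + 4T⁴`, printed (6.2.10)).  The printed theorem also covers `p = 587`
(not typed here: `IsParamodularAwayFrom` omits the level, cell record D-4).
[cite: BrumerEtAl2019, Thm 7.3.1 p. 1191; (6.2.10) p. 1180; (7.3.3) p. 1192; Lemma 7.1.4 p. 1187; p. 1188; Thm 4.3.4 p. 1169; Alg 2.4.1 p. 1155] -/
theorem paramodular_587minus_cited
    {A : AbelianVariety ℚ} {f : Matrix (Fin 2) (Fin 2) ℂ → ℂ} {ρA : FramedGaloisRep ℚ ℤ_[2] 4}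
    {b : Module.Basis (Fin 4) ℚ_[2] (A.rationalTateModule 2)}
    (h438 : BrumerEtAl2019.existsIntegralSymplecticGaloisRep_two_primeLevel)
    (G : GaloisCertificate587 cyclotomicMultiplier ρA)
    (hframe : A.IsFrameOfTateRep 2 b (rationalize ρA)) (aA bA af bf : ℕ → ℤ)
    (hres : ResidualIdentification 587 af bf ρA)
    (hA : ∀ p : ℕ, p.Prime → ¬ p ∣ 587 →
      A.HasGoodEulerFactorAt p ((lPolynomialOfSurface p (aA p) (bA p)).map (Int.castRingHom ℚ)))
    (h5 : ∀ p ∈ checkPrimes587plus, aA p = af p)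
    (hcusp : IsParamodularCuspForm 587 2 f) (hne : ∃ Z ∈ siegelUpperHalfSpace 2, f Z ≠ 0)
    (hfe : ∀ p : ℕ, p.Prime → ¬ p ∣ 587 →
      HasSpinorEulerFactorAt 2 p f ((lPolynomialOfSurface p (af p) (bf p)).map (Int.castRingHom ℂ)))
    (hf3 : af 3 = -4 ∧ bf 3 = 9) (h2 : aA 2 = af 2 ∧ bA 2 = bf 2) :
    IsParamodularAwayFrom A 587 f :=
  haveI : Fact (Nat.Prime 587) := ⟨by norm_num⟩
  paramodular_of_galoisCertificate_cited (by norm_num) h438 G hframe aA bA af bf hres hA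
    checkPrimes587plus_good h5 hcusp hne hfe (typeG_587minus_at_three af bf hf3) h2

/-- **[BPPTVY, Thm 7.3.1] away from `587`, form side cited, Step 1 (R) in the kernel.**
`paramodular_587minus_cited` with `hres` DERIVED by the `S₆` route
(`ResidualIdentification.of_kernel_of_range_eq`) from: `hK : KernelIdentification 587 af bf ρA` (part (F):
"there are only two degree 5 polynomials … and two degree 6 polynomials with field discriminant having
valuation 1 at 587", all but `x⁶ − 2x⁵ + 2x⁴ − x² + 2x − 1` excluded by `Frob₃` / `Frob₁₁` — the Galois
half's `residual` block, candidate lists ×2); `hcard : #im ρ̄_A = 720` (image `S₆`, so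
`im ρ̄_A = ι(S₆)` by `GSp4F2.residual_range_eq_iotaGL_of_card` and the Galois half's `similitude`);
and the Frobenius datum at `q = 3`: `L₃(A₅₈₇) = 1 + 4T + 9T² + 12T³ + 9T⁴`, `a₃ = −4` even (via `h5` and
`hf3`), `b₃ = 9` odd (the binder `hb3`), and `(a₃, b₃)(f⁻) = (−4, 9)` even/odd (`hf3`): `Frob₃²` is the
order-`3` element whose trace fixes the embedding ("same trace at `Frob₃`").  All other binders as in
`paramodular_587minus_cited`. [cite: BrumerEtAl2019, Thm 7.3.1 p. 1191; (5.1.8) p. 1174; Lemma 7.1.4 pp. 1187–1188 (method); Alg 2.4.1 p. 1155] -/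
theorem paramodular_587minus_cited_of_kernel
    {A : AbelianVariety ℚ} {f : Matrix (Fin 2) (Fin 2) ℂ → ℂ} {ρA : FramedGaloisRep ℚ ℤ_[2] 4}
    {b : Module.Basis (Fin 4) ℚ_[2] (A.rationalTateModule 2)}
    (h438 : BrumerEtAl2019.existsIntegralSymplecticGaloisRep_two_primeLevel)
    (G : GaloisCertificate587 cyclotomicMultiplier ρA)
    (hcard : Nat.card (residual ρA.toMonoidHom).range = 720)
    (hframe : A.IsFrameOfTateRep 2 b (rationalize ρA)) (aA bA af bf : ℕ → ℤ)
    (hK : KernelIdentification 587 af bf ρA)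
    (hA : ∀ p : ℕ, p.Prime → ¬ p ∣ 587 →
      A.HasGoodEulerFactorAt p ((lPolynomialOfSurface p (aA p) (bA p)).map (Int.castRingHom ℚ)))
    (hb3 : bA 3 = 9)
    (h5 : ∀ p ∈ checkPrimes587plus, aA p = af p)
    (hcusp : IsParamodularCuspForm 587 2 f) (hne : ∃ Z ∈ siegelUpperHalfSpace 2, f Z ≠ 0)
    (hfe : ∀ p : ℕ, p.Prime → ¬ p ∣ 587 →
      HasSpinorEulerFactorAt 2 p f ((lPolynomialOfSurface p (af p) (bf p)).map (Int.castRingHom ℂ)))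
    (hf3 : af 3 = -4 ∧ bf 3 = 9) (h2 : aA 2 = af 2 ∧ bA 2 = bf 2) :
    IsParamodularAwayFrom A 587 f := by
  have G' : GaloisCertificate 587 checkPrimes587plus cyclotomicMultiplier ρA := G
  have h₁ := GSp4F2.residual_range_eq_iotaGL_of_card ρA cyclotomicMultiplier G'.similitude hcard
  have haA : Even (aA 3) := by rw [h5 3 (by decide), hf3.1]; exact ⟨-2, rfl⟩
  have hbA : Odd (bA 3) := by rw [hb3]; exact ⟨4, rfl⟩
  have haf : Even (af 3) := by rw [hf3.1]; exact ⟨-2, rfl⟩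
  have hbf : Odd (bf 3) := by rw [hf3.2]; exact ⟨4, rfl⟩
  have hres : ResidualIdentification 587 af bf ρA :=
    ResidualIdentification.of_kernel_of_range_eq h₁ hK (q := 3) (by norm_num) (by norm_num) (by norm_num)
      (hasFrobCharpolyAt_of_eulerData hframe (by norm_num) (hA 3 (by norm_num) (by norm_num)))
      ⟨haA, hbA, haf, hbf⟩
  exact paramodular_587minus_cited h438 G hframe aA bA af bf hres hA h5 hcusp hne hfe hf3 h2

/-- Non-vacuity of the numeric side conditions: the four type-(G) inequalities at `(p, a, b) = (3, −4, 9)`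
and the parities even/odd of `(−4, 9)`. [cite: BrumerEtAl2019, Prop 4.3.2 p. 1168; (5.1.8) p. 1174] -/
example : (0 : ℤ) ≤ (-4) ^ 2 - 4 * 9 + 8 * 3 ∧ ((-4 : ℤ)) ^ 2 ≤ 16 * 3 ∧ (0 : ℤ) ≤ 2 * 3 + 9 ∧
    4 * ((-4 : ℤ)) ^ 2 * 3 ≤ (2 * 3 + 9) ^ 2 ∧ Even (-4 : ℤ) ∧ Odd (9 : ℤ) := by
  refine ⟨by norm_num, by norm_num, by norm_num, by norm_num, ⟨-2, rfl⟩, ⟨4, rfl⟩⟩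

end Paramodular587minus

end Literature.NumberTheory.FaltingsSerre

end
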